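import Mathlib
import Summits.ValiantsHypothesis.ValiantsHypothesis.Theorems.FifoMatchingNNNotVPNfpmMonotoneLowerBound
import Summits.ValiantsHypothesis.ValiantsHypothesis.Theorems.FifoMatchingNNNotVPDivisionSplitSharpened
import Summits.ValiantsHypothesis.ValiantsHypothesis.Theorems.FifoMatchingNNNotVPDivisionSplitOfCore
import HarnessLib

/-!
# Route FifoMatching — crux `NNNotVP` (stmt-ValiantsHypothesis-11615), line `division_split`:
# after stub A — what `NNDivisionHard` (stmt-21181) and `NNNotVP` now hinge on, by name

With stub A proved (`stub_supportFnHard`, `…StubSupportFnHard`; its monotone-circuit form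
`nfpmExists_monotone_circuitSize_lowerBound`, `…NfpmMonotoneLowerBound`) and B1 landed earlier
(`stub_certificateToSupportFn`), the compositions of g0 (`…DivisionSplitOfCore`,
`…DivisionSplitSharpened`) lose their A-hypothesis:

* `nnDivisionHard_of_spreadCofactorReduction` — stub B2 (`stub_spreadCofactorReduction`, verbatim)
  ALONE now implies `Theses.FifoMatching.NNDivisionHard` (item stmt-ValiantsHypothesis-21181);
* `nnDivisionHard_of_hyperB2` — indeed its HYPER-DEGREE tier alone does (B2 restricted to
  cofactors of total degree `> 2^⌊n^{1/8}⌋`; the low-degree tier is g0's landed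
  `spreadCofactorReduction_iff_hyperDegree`);
* `nnNotVP_of_zeroOneTransfer_of_hyperB2` — the crux `Theses.FifoMatching.NNNotVP` from the shared
  transfer `Theses.DivisionGap.ZeroOneTransfer` (item stmt-5066 = stub Z) and that tier.

Honest framing: compositions; B2's hyper-degree tier and Z are OPEN (research-size: monotone
cofactor surgery for spread hyper-degree cofactors, resp. the 0/1 division transfer), so
`NNDivisionHard`, `NNNotVP` and `VP ≠ VNP` stay OPEN (NOT proved).  No definitions, no named
facts.
-/

noncomputable section

-- Sub = Summit single-conjunct layout: the duplicated namespace component is mandated by the tree.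
set_option linter.dupNamespace false

namespace Summit.ValiantsHypothesis.ValiantsHypothesis.Theorems.FifoMatching.NNNotVP.DivisionSplit

open MvPolynomial Literature.Computability.AlgebraicComplexity
open Literature.Computability.Complexity
open scoped NNReal BigOperators Classical

/-- **B2 alone ⇒ `NNDivisionHard`** (A = `stub_supportFnHard` and B1 = `stub_certificateToSupportFn`
are proved). [folklore] -/
theorem nnDivisionHard_of_spreadCofactorReduction
    (hB2 : ∃ k : ℕ, ∀ (n : ℕ) (h : MvPolynomial (σ n) ℝ≥0), h ≠ 0 →
      ∃ h' : MvPolynomial (σ n) ℝ≥0, (∃ m ∈ h'.support, m.support.card ≤ (Nat.log 2 n + k) ^ k) ∧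
        complexity (NN n * h') ≤
          2 ^ ((Nat.log 2 n + Nat.log 2 (complexity (NN n * h) + complexity h) + k) ^ k)) :
    Summit.ValiantsHypothesis.ValiantsHypothesis.Theses.FifoMatching.NNDivisionHard :=
  nnDivisionHard_of_stubs stub_supportFnHard hB2

/-- **The hyper-degree tier of B2 alone ⇒ `NNDivisionHard`** (item stmt-ValiantsHypothesis-21181).
[folklore] -/
theorem nnDivisionHard_of_hyperB2
    (hB2 : ∃ k : ℕ, ∀ (n : ℕ) (h : MvPolynomial (σ n) ℝ≥0), h ≠ 0 →
      2 ^ Nat.sqrt (Nat.sqrt (Nat.sqrt n)) < h.totalDegree →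
      ∃ h' : MvPolynomial (σ n) ℝ≥0, (∃ m ∈ h'.support, m.support.card ≤ (Nat.log 2 n + k) ^ k) ∧
        complexity (NN n * h') ≤
          2 ^ ((Nat.log 2 n + Nat.log 2 (complexity (NN n * h) + complexity h) + k) ^ k)) :
    Summit.ValiantsHypothesis.ValiantsHypothesis.Theses.FifoMatching.NNDivisionHard :=
  nnDivisionHard_of_monotoneBoolean_of_hyperB2 nfpmExists_monotone_circuitSize_lowerBound hB2

/-- **Z and the hyper-degree tier of B2 ⇒ the crux `NNNotVP`** (item stmt-ValiantsHypothesis-11615).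
[folklore] -/
theorem nnNotVP_of_zeroOneTransfer_of_hyperB2
    (hZ : Summit.ValiantsHypothesis.ValiantsHypothesis.Theses.DivisionGap.ZeroOneTransfer)
    (hB2 : ∃ k : ℕ, ∀ (n : ℕ) (h : MvPolynomial (σ n) ℝ≥0), h ≠ 0 →
      2 ^ Nat.sqrt (Nat.sqrt (Nat.sqrt n)) < h.totalDegree →
      ∃ h' : MvPolynomial (σ n) ℝ≥0, (∃ m ∈ h'.support, m.support.card ≤ (Nat.log 2 n + k) ^ k) ∧
        complexity (NN n * h') ≤
          2 ^ ((Nat.log 2 n + Nat.log 2 (complexity (NN n * h) + complexity h) + k) ^ k)) :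
    Summit.ValiantsHypothesis.ValiantsHypothesis.Theses.FifoMatching.NNNotVP :=
  nnNotVP_of_monotoneBoolean_of_hyperB2 hZ nfpmExists_monotone_circuitSize_lowerBound hB2

end Summit.ValiantsHypothesis.ValiantsHypothesis.Theorems.FifoMatching.NNNotVP.DivisionSplit

end
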